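import Mathlib
import Summits.Ventures.PercRepro2.Defs
import Summits.Ventures.PercRepro2.Independence
import Summits.Ventures.PercRepro2.Harris
import Summits.Ventures.PercRepro2.Graph
import Summits.Ventures.PercRepro2.Exploration
import Summits.Ventures.PercRepro2.Events
import Summits.Ventures.PercRepro2.FourFunctions
import Summits.Ventures.PercRepro2.Induced
import Summits.Ventures.PercRepro2.Frontier
import Summits.Ventures.PercRepro2.ObsIndependence
import Summits.Ventures.PercRepro2.BHK
import Summits.Ventures.PercRepro2.BHKEvents
import Summits.Ventures.PercRepro2.VdBKahn
import Summits.Ventures.PercRepro2.BHKAvoid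
import Summits.Ventures.PercRepro2.OrderPreservation
import Summits.Ventures.PercRepro2.OrderPreservationDual
import Summits.Ventures.PercRepro2.R2PrimeThreeReduction
import Summits.Ventures.PercRepro2.YBridge
import Summits.Ventures.PercRepro2.Yu1Functionals
import Summits.Ventures.PercRepro2.Yu1Events
import Summits.Ventures.PercRepro2.Yu1

/-!
# Tools for the (Yu1Δ)/(Yu2Δ) regime theorems (blind cell PercRepro2, p1)

Light-first exploration `S = C(a₁)` on `R = {a₂, a₃ ∉ S}` with `Yu1Functionals`' `u`, `β`, `ind`:
* `beta_eq_zero_of_mem`: `β(W) = 0` when `b ∈ W`;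
* `multiplier_antitone`: for `0 ≤ c ≤ c'`, `W ↦ c·(β − 1{b ∈ ·}(1 − u)) − c'·u` is antitone — the
  signed multiplier behind the regime theorems (`YDeltaRegime`);
* tower identities `reg_tower_ob` (`P(o ∈ C₁, b ∈ C₂, R) = E[1_o β; R]`) and `reg_tower_obT`
  (`P(o, b ∈ C₁, a₃ ∈ C₂; R) = E[1_o 1_b (1 − u); R]`), the event identities `dl1_event_eq`,
  `ob_split_eq₁`, `ob_split_eq₂`, `PD_subset_avoid`, `PDEvent_symm`;
* `heavy_mass_eq`: `W_h − W_l = P(a₂ ↔ b) − P(a₁ ↔ b)` (the two one-root masses differ by the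
  labelling gap);
* `expect_lin`: the linearity of `expect` in the shape used.
-/

namespace Summit.Ventures.PercRepro2

open UnionCluster Yu1

section RegimeTools

variable {V : Type*} {E : Type*} [Fintype E] [DecidableEq E] [Fintype V] [DecidableEq V]
  {R : Type*} [Field R] [LinearOrder R] [IsStrictOrderedRing R]

omit [Fintype V] [DecidableEq V] [LinearOrder R] [IsStrictOrderedRing R] in
/-- `β(W) = 0` when `b ∈ W` (`b ≠ a₂`): every edge at `b` is closed in `G ∖ W`. -/
lemma beta_eq_zero_of_mem (p : E → R) (ends : E → Sym2 V) {a₂ b : V} (hb : b ≠ a₂) {W : Set V}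
    (hbW : b ∈ W) : beta p ends a₂ b W = 0 := by
  unfold beta delClusterProb
  have hempty : {ω : Config E | cluster ends (delConfig ends W ω) a₂ ∈ {W' : Set V | b ∈ W'}} = ∅ := by
    ext ω
    simp only [Set.mem_setOf_eq, mem_cluster, Set.mem_empty_iff_false, iff_false]
    intro hconn
    -- the set `{x | x ≠ b}` is closed under open adjacency in `delConfig W ω` and contains `a₂`
    have hclosed : ∀ x ∈ {x : V | x ≠ b}, ∀ y, (openGraph ends (delConfig ends W ω)).Adj x y →
        y ∈ {x : V | x ≠ b} := by
      intro x _ y hxy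
      rw [openGraph_adj] at hxy
      obtain ⟨_, e, he, hends⟩ := hxy
      intro hyb
      subst hyb
      have hmem : e ∈ touches ends W := mem_touches_of_ends hends (Or.inr hbW)
      rw [delConfig_apply_of_mem hmem] at he
      exact Bool.false_ne_true he
    have := mem_of_conn_of_closed hclosed (v := a₂) (u := b) (Ne.symm hb) hconn
    exact this rfl
  rw [hempty, prob_empty]

omit [Fintype V] [DecidableEq V] in
/-- **The multiplier is antitone**: for `0 ≤ c ≤ c'`, `S ↦ c·(β(S) − 1{b ∈ S}(1 − u(S))) − c'·u(S)`
is decreasing in `S` (`b ≠ a₂`). -/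
lemma multiplier_antitone (p : E → R) (hp : IsProbVec p) (ends : E → Sym2 V) {a₂ a₃ b : V}
    (hb : b ≠ a₂) {c c' : R} (hc : 0 ≤ c) (hcc : c ≤ c') :
    Antitone (fun W : Set V => c * (beta p ends a₂ b W - ind b W * (1 - u p ends a₂ a₃ W)) -
      c' * u p ends a₂ a₃ W) := by
  intro W W' hWW'
  simp only
  have hu := u_mono p hp ends a₂ a₃ hWW'
  have hβ := beta_anti p hp ends a₂ b hWW'
  have hu0 := u_nonneg p hp ends a₂ a₃ W
  have hu1 := u_le_one p hp ends a₂ a₃ W'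
  have hu0' := u_nonneg p hp ends a₂ a₃ W'
  have hβ0 := beta_nonneg p hp ends a₂ b W
  have hβ1 := beta_le_one p hp ends a₂ b W
  by_cases hbW : b ∈ W
  · have hbW' : b ∈ W' := hWW' hbW
    rw [beta_eq_zero_of_mem p ends hb hbW, beta_eq_zero_of_mem p ends hb hbW']
    simp only [ind, Set.indicator_of_mem (show W ∈ {W : Set V | b ∈ W} from hbW),
      Set.indicator_of_mem (show W' ∈ {W : Set V | b ∈ W} from hbW'), Pi.one_apply]
    nlinarith
  · have h0 : (ind b W : R) = 0 := by
      unfold ind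
      exact Set.indicator_of_notMem (show W ∉ {W' : Set V | b ∈ W'} from hbW) _
    rw [h0]
    by_cases hbW' : b ∈ W'
    · rw [beta_eq_zero_of_mem p ends hb hbW']
      simp only [ind, Set.indicator_of_mem (show W' ∈ {W : Set V | b ∈ W} from hbW'), Pi.one_apply]
      nlinarith
    · have h0' : (ind b W' : R) = 0 := by
        unfold ind
        exact Set.indicator_of_notMem (show W' ∉ {W'' : Set V | b ∈ W''} from hbW') _
      rw [h0']
      nlinarith

omit [LinearOrder R] [IsStrictOrderedRing R] in
/-- Tower identity: `P(o ∈ C₁, b ∈ C₂, R) = E[1_o(C₁) β(C₁); R]`. -/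
lemma reg_tower_ob (p : E → R) (ends : E → Sym2 V) (o a₁ a₂ a₃ b : V) :
    prob p (connEvent ends a₁ o ∩ connEvent ends a₂ b ∩ avoidAll ends a₁ {a₂, a₃}) =
      expect p (fun ω => ind o (cluster ends ω a₁) * beta p ends a₂ b (cluster ends ω a₁) *
        (avoidAll ends a₁ {a₂, a₃}).indicator 1 ω) := by
  rw [connEvent_eq_clusterInEvent ends a₁ o, connEvent_eq_clusterInEvent ends a₂ b,
    prob_clusterIn_inter_avoid_eq_expect p ends a₁ a₂ (X := {a₂, a₃})
    (Finset.mem_insert_self a₂ {a₃})]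
  rfl

omit [LinearOrder R] [IsStrictOrderedRing R] in
/-- Tower identity: `P(o, b ∈ C₁, a₃ ∈ C₂; R) = E[1_o 1_b (1 − u); R]`. -/
lemma reg_tower_obT (p : E → R) (ends : E → Sym2 V) (o a₁ a₂ a₃ b : V) :
    prob p (connEvent ends a₁ o ∩ connEvent ends a₁ b ∩ connEvent ends a₂ a₃ ∩
        avoidAll ends a₁ {a₂, a₃}) =
      expect p (fun ω => ind o (cluster ends ω a₁) * ind b (cluster ends ω a₁) *
        (1 - u p ends a₂ a₃ (cluster ends ω a₁)) * (avoidAll ends a₁ {a₂, a₃}).indicator 1 ω) := by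
  have e : connEvent ends a₁ o ∩ connEvent ends a₁ b ∩ connEvent ends a₂ a₃ ∩
      avoidAll ends a₁ {a₂, a₃} =
      clusterInEvent ends a₁ ({W | o ∈ W} ∩ {W | b ∈ W}) ∩ clusterInEvent ends a₂ {W | a₃ ∈ W} ∩
        avoidAll ends a₁ {a₂, a₃} := by
    ext ω
    simp [clusterInEvent]
  rw [e, prob_clusterIn_inter_avoid_eq_expect p ends a₁ a₂ (X := {a₂, a₃})
    (Finset.mem_insert_self a₂ {a₃})]
  unfold expect
  refine Finset.sum_congr rfl fun ω _ => ?_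
  simp only []
  rw [one_sub_u]
  unfold ind
  by_cases ho : o ∈ cluster ends ω a₁ <;> by_cases hb : b ∈ cluster ends ω a₁ <;>
    simp [ho, hb]

omit [Fintype E] [DecidableEq E] [Fintype V] in
/-- `{C₁ ≠ C₂, o ∈ C₁, a₃ ∈ C₂, b ∈ C₁}` in the `avoidAll` spelling. -/
lemma dl1_event_eq (ends : E → Sym2 V) (o a₁ a₂ a₃ b : V) :
    (connEvent ends a₁ a₂)ᶜ ∩ connEvent ends a₁ o ∩ connEvent ends a₂ a₃ ∩ connEvent ends a₁ b =
      connEvent ends a₁ o ∩ connEvent ends a₁ b ∩ connEvent ends a₂ a₃ ∩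
        avoidAll ends a₁ {a₂, a₃} := by
  ext ω
  simp only [Set.mem_inter_iff, Set.mem_compl_iff, mem_connEvent, avoidAll, Set.mem_setOf_eq,
    Finset.mem_insert, Finset.mem_singleton, forall_eq_or_imp, forall_eq]
  constructor
  · rintro ⟨⟨⟨h12, h1o⟩, h23⟩, h1b⟩
    exact ⟨⟨⟨h1o, h1b⟩, h23⟩, h12, fun h => h12 (conn_trans h (conn_symm h23))⟩
  · rintro ⟨⟨⟨h1o, h1b⟩, h23⟩, h12, _⟩
    exact ⟨⟨⟨h12, h1o⟩, h23⟩, h1b⟩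

omit [Fintype E] [DecidableEq E] [Fintype V] in
/-- `{o ∈ C₁, b ∈ C₂, R, a₃ ∈ C₂}` is `Δ_l`'s second event. -/
lemma ob_split_eq₁ (ends : E → Sym2 V) (o a₁ a₂ a₃ b : V) :
    connEvent ends a₁ o ∩ connEvent ends a₂ b ∩ avoidAll ends a₁ {a₂, a₃} ∩
        connEvent ends a₂ a₃ =
      (connEvent ends a₁ a₂)ᶜ ∩ connEvent ends a₁ o ∩ connEvent ends a₂ a₃ ∩ connEvent ends a₂ b := by
  ext ω
  simp only [Set.mem_inter_iff, Set.mem_compl_iff, mem_connEvent, avoidAll, Set.mem_setOf_eq,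
    Finset.mem_insert, Finset.mem_singleton, forall_eq_or_imp, forall_eq]
  constructor
  · rintro ⟨⟨⟨h1o, h2b⟩, h12, _⟩, h23⟩
    exact ⟨⟨⟨h12, h1o⟩, h23⟩, h2b⟩
  · rintro ⟨⟨⟨h12, h1o⟩, h23⟩, h2b⟩
    exact ⟨⟨⟨h1o, h2b⟩, h12, fun h => h12 (conn_trans h (conn_symm h23))⟩, h23⟩

omit [Fintype E] [DecidableEq E] [Fintype V] in
/-- `{o ∈ C₁, b ∈ C₂, R, a₃ ∉ C₂}` is `T_{l→h}`'s event. -/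
lemma ob_split_eq₂ (ends : E → Sym2 V) (o a₁ a₂ a₃ b : V) :
    connEvent ends a₁ o ∩ connEvent ends a₂ b ∩ avoidAll ends a₁ {a₂, a₃} ∩
        (connEvent ends a₂ a₃)ᶜ =
      PDEvent ends a₁ a₂ a₃ ∩ connEvent ends a₁ o ∩ connEvent ends a₂ b := by
  ext ω
  simp only [PDEvent, Dtilde, inU, Set.mem_inter_iff, Set.mem_compl_iff, Set.mem_union,
    mem_connEvent, avoidAll, Set.mem_setOf_eq, Finset.mem_insert, Finset.mem_singleton,
    forall_eq_or_imp, forall_eq, not_or]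
  constructor
  · rintro ⟨⟨⟨h1o, h2b⟩, h12, h13⟩, h23⟩
    exact ⟨⟨⟨h12, fun h => h13 (conn_symm h), fun h => h23 (conn_symm h)⟩, h1o⟩, h2b⟩
  · rintro ⟨⟨⟨h12, h31, h32⟩, h1o⟩, h2b⟩
    exact ⟨⟨⟨h1o, h2b⟩, h12, fun h => h31 (conn_symm h)⟩, fun h => h32 (conn_symm h)⟩

omit [Fintype V] [DecidableEq V] [LinearOrder R] [IsStrictOrderedRing R] in
/-- Linearity of `expect` in the shape used below. -/
lemma expect_lin (p : E → R) (c₁ c₂ : R) (f₁ f₂ f₃ : Config E → R) :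
    expect p (fun ω => c₁ * (f₁ ω - f₂ ω) - c₂ * f₃ ω) =
      c₁ * (expect p f₁ - expect p f₂) - c₂ * expect p f₃ := by
  simp only [expect]
  have h : ∀ x, weight p x * (c₁ * (f₁ x - f₂ x) - c₂ * f₃ x) =
      c₁ * (weight p x * f₁ x) - c₁ * (weight p x * f₂ x) - c₂ * (weight p x * f₃ x) :=
    fun x => by ring
  simp only [h, Finset.sum_sub_distrib, ← Finset.mul_sum]
  ring

omit [Fintype E] [DecidableEq E] [Fintype V] in
/-- `PD ⊆ R`. -/
lemma PD_subset_avoid (ends : E → Sym2 V) (a₁ a₂ a₃ : V) :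
    PDEvent ends a₁ a₂ a₃ ⊆ avoidAll ends a₁ {a₂, a₃} := by
  rintro ω ⟨h12, h3⟩
  simp only [Dtilde, inU, Set.mem_compl_iff, Set.mem_union, mem_connEvent, not_or] at h3
  simp only [avoidAll, Set.mem_setOf_eq, Finset.mem_insert, Finset.mem_singleton, forall_eq_or_imp,
    forall_eq]
  exact ⟨h12, fun h => h3.1 (conn_symm h)⟩

omit [Fintype E] [DecidableEq E] [Fintype V] [DecidableEq V] in
/-- `PD` is symmetric in the two better roots. -/
lemma PDEvent_symm (ends : E → Sym2 V) (a₁ a₂ a₃ : V) :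
    PDEvent ends a₂ a₁ a₃ = PDEvent ends a₁ a₂ a₃ := by
  ext ω
  simp only [PDEvent, Dtilde, inU, Set.mem_inter_iff, Set.mem_compl_iff, Set.mem_union,
    mem_connEvent, not_or]
  constructor
  · rintro ⟨h21, h32, h31⟩
    exact ⟨fun h => h21 (conn_symm h), h31, h32⟩
  · rintro ⟨h12, h31, h32⟩
    exact ⟨fun h => h12 (conn_symm h), h32, h31⟩

omit [Fintype V] in
/-- **`W_h − W_l = gap`**: with `W_h = P(b ∈ C₂, R) − P(b ∈ C₁, T)` (`R = {a₂, a₃ ∉ C₁}`,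
`T = {a₁ ↮ a₂, a₃ ∈ C₂}`) and `W_l = P(b ∈ C₁, R′) − P(b ∈ C₂, T′)` (`R′ = {a₁, a₃ ∉ C₂}`,
`T′ = {a₁ ↮ a₂, a₃ ∈ C₁}`): `W_h − W_l = P(a₂ ↔ b) − P(a₁ ↔ b)`. -/
lemma heavy_mass_eq (p : E → R) (ends : E → Sym2 V) (a₁ a₂ a₃ b : V) :
    (prob p (connEvent ends a₂ b ∩ avoidAll ends a₁ {a₂, a₃}) -
        prob p (connEvent ends a₁ b ∩ TEvent ends a₁ a₂ a₃)) -
      (prob p (connEvent ends a₁ b ∩ avoidAll ends a₂ {a₁, a₃}) -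
        prob p (connEvent ends a₂ b ∩ TEvent ends a₂ a₁ a₃)) =
      prob p (connEvent ends a₂ b) - prob p (connEvent ends a₁ b) := by
  -- `P(a₂ ↔ b) = P(a₂ ↔ b, a₁ ↔ a₂) + P(a₂ ↔ b, R) + P(a₂ ↔ b, T′)`, and mirror
  have s1 := prob_inter_add_prob_inter_compl p (connEvent ends a₂ b) (connEvent ends a₁ a₂)
  have s2 := prob_inter_add_prob_inter_compl p (connEvent ends a₂ b ∩ (connEvent ends a₁ a₂)ᶜ)
    (connEvent ends a₁ a₃)
  have s3 := prob_inter_add_prob_inter_compl p (connEvent ends a₁ b) (connEvent ends a₁ a₂)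
  have s4 := prob_inter_add_prob_inter_compl p (connEvent ends a₁ b ∩ (connEvent ends a₁ a₂)ᶜ)
    (connEvent ends a₂ a₃)
  have ecom : connEvent ends a₂ b ∩ connEvent ends a₁ a₂ = connEvent ends a₁ b ∩ connEvent ends a₁ a₂ := by
    ext ω
    simp only [Set.mem_inter_iff, mem_connEvent]
    exact ⟨fun ⟨h1, h2⟩ => ⟨conn_trans h2 h1, h2⟩, fun ⟨h1, h2⟩ => ⟨conn_trans (conn_symm h2) h1, h2⟩⟩
  have e1 : connEvent ends a₂ b ∩ (connEvent ends a₁ a₂)ᶜ ∩ connEvent ends a₁ a₃ =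
      connEvent ends a₂ b ∩ TEvent ends a₂ a₁ a₃ := by
    ext ω
    simp only [TEvent, Set.mem_inter_iff, Set.mem_compl_iff, mem_connEvent]
    exact ⟨fun ⟨⟨h1, h2⟩, h3⟩ => ⟨h1, h2, h3⟩, fun ⟨h1, h2, h3⟩ => ⟨⟨h1, h2⟩, h3⟩⟩
  have e2 : connEvent ends a₂ b ∩ (connEvent ends a₁ a₂)ᶜ ∩ (connEvent ends a₁ a₃)ᶜ =
      connEvent ends a₂ b ∩ avoidAll ends a₁ {a₂, a₃} := by
    ext ω
    simp only [Set.mem_inter_iff, Set.mem_compl_iff, mem_connEvent, avoidAll, Set.mem_setOf_eq,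
      Finset.mem_insert, Finset.mem_singleton, forall_eq_or_imp, forall_eq]
    tauto
  have e3 : connEvent ends a₁ b ∩ (connEvent ends a₁ a₂)ᶜ ∩ connEvent ends a₂ a₃ =
      connEvent ends a₁ b ∩ TEvent ends a₁ a₂ a₃ := by
    ext ω
    simp only [TEvent, Set.mem_inter_iff, Set.mem_compl_iff, mem_connEvent]
    exact ⟨fun ⟨⟨h1, h2⟩, h3⟩ => ⟨h1, fun h => h2 (conn_symm h), h3⟩,
      fun ⟨h1, h2, h3⟩ => ⟨⟨h1, fun h => h2 (conn_symm h)⟩, h3⟩⟩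
  have e4 : connEvent ends a₁ b ∩ (connEvent ends a₁ a₂)ᶜ ∩ (connEvent ends a₂ a₃)ᶜ =
      connEvent ends a₁ b ∩ avoidAll ends a₂ {a₁, a₃} := by
    ext ω
    simp only [Set.mem_inter_iff, Set.mem_compl_iff, mem_connEvent, avoidAll, Set.mem_setOf_eq,
      Finset.mem_insert, Finset.mem_singleton, forall_eq_or_imp, forall_eq]
    constructor
    · rintro ⟨⟨h1, h2⟩, h3⟩
      exact ⟨h1, fun h => h2 (conn_symm h), h3⟩
    · rintro ⟨h1, h2, h3⟩
      exact ⟨⟨h1, fun h => h2 (conn_symm h)⟩, h3⟩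
  rw [ecom] at s1
  rw [e1, e2] at s2
  rw [e3, e4] at s4
  linarith

end RegimeTools

end Summit.Ventures.PercRepro2
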